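import Mathlib
import Summits.PneNP.PneNP.Theorems.PstarPDTOfResLin
import Literature.Computability.MetaComplexity.ResLinProverDelayer
import Literature.Computability.MetaComplexity.PremiseDagAncestors

/-!
# Tree-like `Res(⊕)` refutations of a fibre CNF unfold to parity decision trees of no larger SIZE (ROUND-24, item T24.3c, size form)

FRONTIER range-avoidance ladder, rung F-N3 (cell `pnp-ideate`; restricted-model proof complexity — nothing here bears on `P` vs
`NP`).

`PstarPDTOfResLin` unfolds a `Res(⊕)` refutation `π` of `fibreCNF I y` into the parity decision tree `treeAt π t` attached to
each line and bounds its DEPTH by the DAG depth.  For TREE-LIKE refutations (every line used as a premise at most once — the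
hypothesis of the library's `ProverDelayer.two_pow_le_length_of_guarantees`) the unfolding does not duplicate anything, so the
SIZE is bounded too: the tree attached to line `t` has at most `|dagAncestors t|` leaves (the sub-derivation ending in `t`;
the two premises of a resolution step have disjoint sub-derivations, `PremiseDagAncestors.card_dagAncestors_add_lt`).  Hence

* `exists_solves_size_le` — a tree-like `Res(⊕)` refutation `π` of `fibreCNF I y` yields a parity decision tree solving
  `Search(I, y)` with `size ≤ π.length` (and `depth ≤ resLinDepth π`);
* `le_length_of_forall_solves` — a SIZE lower bound for solving parity decision trees is a size lower bound for tree-like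
  `Res(⊕)` refutations of the fibre CNF (the Itsykson–Sokolov correspondence, in the direction «PDT size ⇒ tree-like `Res(⊕)`
  size»; the library's coins lemma and `PstarPDTResLin` give the Delayer route to both).

So of the held ROUND-24 statements, «every solving PDT has size `≥ 2^{n/c}`» implies «every tree-like `Res(⊕)` refutation of
`fibreCNF I y` has `≥ 2^{n/c}` lines» by this file alone.
-/

set_option linter.dupNamespace false

open Finset Literature.Computability.Complexity Literature.Computability.MetaComplexity
open Summit.PneNP.PneNP.Theorems.PstarPDT (PDT)
open Summit.PneNP.PneNP.Theorems.PstarFibreCNF (fibreCNF)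

namespace Summit.PneNP.PneNP.Theorems.PstarPDTOfResLin

variable {k n m : ℕ} {I : LocalMap k n m} {y : Fin m → Bool} {j₀ : Fin m} {π : List ResLinLine}

/-- **Size of the unfolding under tree-likeness.**  On a valid TREE-LIKE derivation, the tree attached to line `t` has at most as
many leaves as the sub-derivation ending in `t` has lines. -/
theorem size_treeAt_le (hπ : IsResLinDerivation (fibreCNF I y) π)
    (htree : ∀ i : ℕ, (π.map fun l => l.premises.count i).sum ≤ 1) : ∀ (t : ℕ), t < π.length →
    (treeAt I y j₀ π t).size ≤ (dagAncestors (π.map ResLinLine.premises) t).card := by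
  have hprem : IsPremiseDag (π.map ResLinLine.premises) := ProverDelayer.isPremiseDag_of_isResLinDerivation hπ
  have htree' : IsTreeLikeDag (π.map ResLinLine.premises) := ProverDelayer.isTreeLikeDag_of_treeLike htree
  intro t
  induction t using Nat.strong_induction_on with
  | _ t ih =>
  intro ht
  have hval := hπ t ht
  have hlen : (π.take t).length = t := by rw [List.length_take]; omega
  have htm : t < (π.map ResLinLine.premises).length := by simpa using ht
  have hprem_t : (π.map ResLinLine.premises)[t]'htm = (π[t]).rule.premises := by
    simp [ResLinLine.premises]
  unfold IsValidResLinLine at hval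
  rw [treeAt, List.getElem?_eq_getElem ht]
  simp only
  rcases hr : (π[t]).rule with _ | ⟨i, j, f⟩ | i
  · simpa [PDT.size] using card_dagAncestors_pos (prem := π.map ResLinLine.premises) t
  · simp only [hr] at hval ⊢
    obtain ⟨hi, hj, -⟩ := hval
    rw [hlen] at hi hj
    rw [dif_pos ⟨hi, hj⟩]
    simp only [PDT.size]
    have hpt : (π.map ResLinLine.premises)[t]'htm = [i, j] := by rw [hprem_t, hr]; rfl
    have hci : DagConsumes (π.map ResLinLine.premises) i t := ⟨htm, by rw [hpt]; simp⟩
    have hcj : DagConsumes (π.map ResLinLine.premises) j t := ⟨htm, by rw [hpt]; simp⟩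
    have hij : i ≠ j := ne_of_isTreeLikeDag_pair htree' htm hpt
    have h1 := ih i hi (by omega)
    have h2 := ih j hj (by omega)
    have h3 := card_dagAncestors_add_lt hprem htree' hci hcj hij
    omega
  · simp only [hr] at hval ⊢
    obtain ⟨hi, -⟩ := hval
    rw [hlen] at hi
    rw [dif_pos hi]
    have hpt : (π.map ResLinLine.premises)[t]'htm = [i] := by rw [hprem_t, hr]; rfl
    have hci : DagConsumes (π.map ResLinLine.premises) i t := ⟨htm, by rw [hpt]; simp⟩
    exact (ih i hi (by omega)).trans (card_dagAncestors_le_of_dagConsumes hprem hci)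

/-- **T24.3c, size form — tree-like `Res(⊕)` refutations unfold to parity decision trees of no larger size.**  A tree-like
`Res(⊕)` refutation `π` of the fibre CNF of `I : LocalMap k n m` at `y` yields a parity decision tree solving `Search(I, y)` with at
most `π.length` leaves and depth at most `resLinDepth π`. -/
theorem exists_solves_size_le (h : IsResLinRefutation (fibreCNF I y) π)
    (htree : ∀ i : ℕ, (π.map fun l => l.premises.count i).sum ≤ 1) :
    ∃ T : PDT n m, T.Solves I y ∧ T.size ≤ π.length ∧ T.depth ≤ resLinDepth π := by
  obtain ⟨hder, l, hl, hempty⟩ := h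
  obtain ⟨t, ht, rfl⟩ := List.getElem_of_mem hl
  rcases Nat.eq_zero_or_pos m with hm | hm
  · exfalso
    subst hm
    have hnil : fibreCNF I y = [] := by
      unfold PstarFibreCNF.fibreCNF
      simp
    rw [hnil] at hder
    have := eq_nil_of_isResLinDerivation_nil hder
    subst this
    exact absurd ht (Nat.not_lt_zero _)
  refine ⟨treeAt I y ⟨0, hm⟩ π t, fun z => (treeAt_spec (j₀ := ⟨0, hm⟩) hder t ht).1 z ?_, ?_, ?_⟩
  · rw [hempty]
    rfl
  · exact (size_treeAt_le (j₀ := ⟨0, hm⟩) hder htree t ht).trans ((card_dagAncestors_le _).trans (by omega))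
  · exact (treeAt_spec (j₀ := ⟨0, hm⟩) hder t ht).2.trans (getD_dagDepthList_le_dagDepth _ _)

/-- Hence a SIZE lower bound for solving parity decision trees is a size lower bound for every tree-like `Res(⊕)` refutation of
the fibre CNF. -/
theorem le_length_of_forall_solves {s : ℕ} (hs : ∀ T : PDT n m, T.Solves I y → s ≤ T.size)
    (h : IsResLinRefutation (fibreCNF I y) π) (htree : ∀ i : ℕ, (π.map fun l => l.premises.count i).sum ≤ 1) :
    s ≤ π.length := by
  obtain ⟨T, hT, hsize, -⟩ := exists_solves_size_le h htree
  exact (hs T hT).trans hsize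

end Summit.PneNP.PneNP.Theorems.PstarPDTOfResLin
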